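import Summits.BirchSwinnertonDyer.BirchSwinnertonDyer.Theses.ShadowIsolation
import Literature.NumberTheory.EllipticCurves.ZpCorankQuasiIso

/-!
# BirchSwinnertonDyer / ShadowIsolation — support item `ShaUnboundedOfCorank` (stmt-BirchSwinnertonDyer-15490)

Pure algebra of the tree's corank formula `zpCorank A p = dim_{𝔽_p} A[p] − dim_{𝔽_p} A/pA`
(Greenberg 1999, §1): if `shaCorank W p ≠ 0` then `Ш(W)` has an element of every exact order `p ^ n`.

Proof (steps (A)+(B) of the route's certified deciding theorem `ShadowIsolation.closes`, extracted;
(A) is the proved Literature lemma `zpCorank_of_finite_eq_zero`): if no element of `Ш(W)` has exact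
order `p ^ n` then `p ^ n` kills `A = Ш(W)[p^∞]` (an element of order `p ^ m`, `m ≥ n`, has a multiple
of exact order `p ^ n`); `A[p]` is finite (else its `finrank` is the junk value `0` and so is the
formula); hence `A = A[p^n]` is finite (`finite_torsionBy_pow`) and a finite group has corank formula
`0` — contradiction.
-/

-- D-0017: single-problem summit, so `Summit.BirchSwinnertonDyer.BirchSwinnertonDyer.…` repeats a
-- namespace BY DESIGN.
set_option linter.dupNamespace false

namespace Summit.BirchSwinnertonDyer.BirchSwinnertonDyer.Theorems

open Summit.BirchSwinnertonDyer.BirchSwinnertonDyer.Theses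

/-- **`ShaUnboundedOfCorank` (stmt-BirchSwinnertonDyer-15490).** If the `ℤ_p`-corank formula of
`Ш(W)[p^∞]` is non-zero then `Ш(W)` has an element of exact order `p ^ n` for every `n`: otherwise
`p ^ n` kills `A = Ш(W)[p^∞]` (an element of order `p ^ m`, `m ≥ n`, has a multiple of exact order
`p ^ n`), `A[p]` is finite (else `finrank` is the junk `0` and so is the formula), hence `A = A[p^n]`
is finite (`finite_torsionBy_pow`) and a finite group has corank formula `0`
(`zpCorank_of_finite_eq_zero`). Greenberg (1999), *Iwasawa theory for elliptic curves*, §1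
(structure of cofinitely generated `ℤ_p`-modules). [cite: Greenberg1999LNM, §1] -/
theorem shaUnboundedOfCorank_proof : ShadowIsolation.ShaUnboundedOfCorank := by
  unfold ShadowIsolation.ShaUnboundedOfCorank
  intro W _ p hp hcor n
  classical
  have hpp : p.Prime := hp.out
  by_contra hno
  push Not at hno
  apply hcor
  -- the `p`-primary part `A = Ш[p^∞]` of `Ш(W)`
  set A : AddSubgroup ↥W.sha := AddCommGroup.primaryComponent (↥W.sha) p
  show Literature.NumberTheory.EllipticCurves.zpCorank (↥A) p = 0
  -- (B1) `p ^ n` kills `A`: an element of order `p ^ m`, `m ≥ n`, would have a multiple of exact order `p ^ n`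
  have hkill : ∀ a : ↥A, p ^ n • a = 0 := by
    intro a
    obtain ⟨k, hk⟩ : ∃ k : ℕ, p ^ k • (a : ↥W.sha) = 0 := a.2
    have hdvd : addOrderOf (a : ↥W.sha) ∣ p ^ k := addOrderOf_dvd_of_nsmul_eq_zero hk
    obtain ⟨m, -, hm⟩ := (Nat.dvd_prime_pow hpp).1 hdvd
    by_cases hmn : n ≤ m
    · exfalso
      have hne : addOrderOf (a : ↥W.sha) ≠ 0 := by rw [hm]; exact pow_ne_zero _ hpp.ne_zero
      have hdiv : p ^ n ∣ addOrderOf (a : ↥W.sha) := by rw [hm]; exact pow_dvd_pow p hmn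
      exact hno _ (addOrderOf_nsmul_addOrderOf_sub hne hdiv)
    · push Not at hmn
      have hdiv : addOrderOf (a : ↥W.sha) ∣ p ^ n := by rw [hm]; exact pow_dvd_pow p hmn.le
      apply Subtype.ext
      rw [AddSubgroupClass.coe_nsmul, ZeroMemClass.coe_zero]
      exact addOrderOf_dvd_iff_nsmul_eq_zero.mp hdiv
  -- (B2) `A[p]` is finite: otherwise its `finrank` is the junk value `0` and the corank formula is `0`
  haveI hfinp : Finite ↥(AddSubgroup.torsionBy (↥A) (p : ℤ)) := by
    by_contra hinf
    apply hcor
    show Literature.NumberTheory.EllipticCurves.zpCorank (↥A) p = 0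
    unfold Literature.NumberTheory.EllipticCurves.zpCorank
    letI : Module (ZMod p) (AddSubgroup.torsionBy (↥A) (p : ℤ)) := AddSubgroup.torsionBy.zmodModule
    have h0 : Module.finrank (ZMod p) (AddSubgroup.torsionBy (↥A) (p : ℤ)) = 0 := by
      apply Module.finrank_of_not_finite
      intro hf
      exact hinf (Module.finite_of_finite (ZMod p))
    rw [h0, Nat.zero_sub]
  -- (B3) hence `A = A[p^n]` is finite, and (A) a finite group has corank formula `0`
  haveI : Finite ↥(AddSubgroup.torsionBy (↥A) ((p ^ n : ℕ) : ℤ)) :=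
    Literature.NumberTheory.EllipticCurves.finite_torsionBy_pow (↥A) p n
  haveI : Finite ↥A :=
    Finite.of_injective
      (fun a : ↥A => (⟨a, AddSubgroup.torsionBy.nsmul_iff.mpr (hkill a)⟩ :
        ↥(AddSubgroup.torsionBy (↥A) ((p ^ n : ℕ) : ℤ))))
      (fun a b h => by simpa using congrArg Subtype.val h)
  exact Literature.NumberTheory.EllipticCurves.zpCorank_of_finite_eq_zero (A := ↥A) p

end Summit.BirchSwinnertonDyer.BirchSwinnertonDyer.Theorems
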